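import Summits.AnomalousDissipation.AnomalousDissipation.Theorems.BaireTransferRobustLoudUpgradePoly
import Summits.AnomalousDissipation.AnomalousDissipation.Theorems.BaireTransferRobustLoudUpgradeStubSegmentSteadyForce
import Summits.AnomalousDissipation.AnomalousDissipation.Theorems.BaireTransferRobustLoudUpgradeStubPersistSmoothForce

/-!
# Line `malkin-cone-group-orbits`, reshape c14 (cycle 2): THE STEADY UPGRADE FOR SMOOTH FORCES — census door R3 (steady half)
# as a theorem of the tree (crux `BaireTransfer.RobustLoudUpgrade`, stmt-AnomalousDissipation-1144)

Pure proof file (no definitions).  The strategist census of this crux (`Cruxes/RobustLoudUpgrade/STRATEGY-CENSUS.md`) locates the whole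
STEADY obstruction of `RobustLoudUpgrade` in the finite-dimensionality of the force family `P_S` (W2, R3) and records the two-line proof in an
infinite-dimensional force space (T1): the designer segment `u_t = t·u₀`, `f_t = t²f + (t²−t)ν Δu₀`, analytic Fredholm alternative along
`t`, implicit-function theorem.  This file makes that prose a theorem WITHOUT introducing a force space or a topology — in ε–δ form, for
ARBITRARY smooth forces and `L²`-small smooth admissible perturbations:

* `smoothForce_steady_upgrade` (registered sub-goal): if a smooth force `f` carries, at `ν ∈ (0,a)`, a classical steady state `u₀` of any mean
  with `meanEnergy ≤ E`, `meanDissipation ≥ ε > 0`, then for every `δ > 0` some `t` with `|t − 1| < δ` makes the designer force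
  `f_t := t²f + (t²−t)ν Δu₀` carry an `L²`-BALL of relaxed-loud forces: every smooth divergence-free mean-zero `g` with `∫‖g − f_t‖² < r`
  has a classical steady state of `NS_ν` with `meanEnergy < 2E`, `meanDissipation > ε/2`.  Hence in ANY vector topology on smooth admissible
  forces between `L²` and `C^∞` a steady-loud force lies in the closure of the interior of the relaxed-loud set.

Ingredients, all landed for this line: Riesz–Schauder along the segment (`Poly.segmentNondeg_finite` ← `EigenFinite`, `RealKernel`,
`SegmentNondeg`), the segment of exact steady states for a general force (`SegmentSteadyForce.stub_segmentSteadyForce`), budgets along the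
segment (`SegmentBudget`), persistence of leaf-nondegenerate steady states under `L²`-small smooth admissible perturbations
(`PersistSmoothForce.stub_persistSmoothForce`), and the Peter–Paul window (`SteadyWindow.integral_norm_sq_le`, `gradNormSq_le`).

References: Foias–Temam 1977 §1; Saut–Temam 1980 §2; Temam 1979 Ch. II §1; Rudin, *Functional Analysis* Thm. 4.24–4.25;
`Cruxes/RobustLoudUpgrade/STRATEGY-CENSUS.md` (T1, W2, R3).
-/

-- `Summit.<Summit>.<Problem>` is the tree's mandated summit-side namespace (CONVENTIONS §2); for this
-- single-conjunct summit the two coincide, so the duplicate is deliberate.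
set_option linter.dupNamespace false

noncomputable section

open scoped BigOperators Topology
open Filter Set Function TopologicalSpace MeasureTheory

namespace Summit.AnomalousDissipation.AnomalousDissipation.Theorems.RobustLoudUpgrade

open Literature.Analysis.FunctionSpaces Literature.Analysis.FunctionSpaces.Torus
open Literature.Analysis.FluidPDE
open Summit.AnomalousDissipation.AnomalousDissipation.Theses.BaireTransfer

namespace Poly

/-! ## The smooth-force steady upgrade: census door R3, steady half, as a theorem -/

/-- **Steady upgrade for smooth forces** (the infinite-dimensional statement of census T1/R3 in ε–δ form, no force family, no topology on
forces needed): let `f` be a smooth force (its gradient part rides with the pressure) carrying, at a viscosity `ν ∈ (0,a)`, a classical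
steady state `u₀` of any mean with `meanEnergy ≤ E` and `meanDissipation ≥ ε > 0`.  Then for every `δ > 0` there is `t` with `|t − 1| < δ` such that the designer
force `f_t := t²f + (t²−t)ν Δu₀` (smooth, `C^∞`-close to `f` as `t → 1`) has an `L²`-NEIGHBOURHOOD of relaxed-loud forces: every smooth
divergence-free mean-zero `g` with `∫‖g − f_t‖² < r` carries a classical steady state of `NS_ν` with `meanEnergy < 2E`,
`meanDissipation > ε/2`.  (Riesz–Schauder along the segment — `EigenFinite`, `RealKernel`, `SegmentNondeg` —, the segment of exact steady
states, persistence under `L²`-small smooth perturbations, and the Peter–Paul window.)  In words: in ANY vector topology on smooth admissible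
forces between `L²` and `C^∞`, a steady-loud force lies in the closure of the interior of the relaxed-loud set — finite-dimensionality of
`P_S` is the whole steady obstruction of the crux. [folklore] -/
theorem smoothForce_steady_upgrade :
    ∀ (ν a E ε : ℝ) (f u₀ : UnitAddTorus (Fin 3) → EuclideanSpace ℝ (Fin 3)) (p₀ : UnitAddTorus (Fin 3) → ℝ) (δ : ℝ),
      0 < ε → 0 < ν → ν < a → IsSmooth f → Torus.IsSteadyNSState ν f u₀ p₀ →
      meanEnergy (fun _ : ℝ => u₀) ≤ E → ε ≤ meanDissipation ν (fun _ : ℝ => u₀) → 0 < δ →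
      ∃ t : ℝ, |t - 1| < δ ∧ ∃ r : ℝ, 0 < r ∧
        ∀ g : UnitAddTorus (Fin 3) → EuclideanSpace ℝ (Fin 3), IsSmooth g → IsDivFree g → HasZeroMean g →
          (∫ x, ‖g x - (t ^ 2 • f x + ((t ^ 2 - t) * ν) • laplacian u₀ x)‖ ^ 2) < r →
          ∃ (u' : UnitAddTorus (Fin 3) → EuclideanSpace ℝ (Fin 3)) (p' : UnitAddTorus (Fin 3) → ℝ),
            Torus.IsSteadyNSState ν g u' p' ∧ meanEnergy (fun _ : ℝ => u') < 2 * E ∧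
              ε / 2 < meanDissipation ν (fun _ : ℝ => u') := by
  intro ν a E ε f u₀ p₀ δ hε hν _hνa hfs hst hE hD hδ
  have hsm₀ : IsSmooth u₀ := hst.smooth_velocity.isSmooth_slice (Set.mem_univ (0 : ℝ))
  have hdiv₀ : IsDivFree u₀ := hst.divFree 0 (Set.mem_univ 0)
  -- budgets of `u₀` as integrals
  set A₀ : ℝ := ∫ x, ‖u₀ x‖ ^ 2 with hA₀
  set G₀ : ℝ := gradNormSq u₀ with hG₀
  have hA : A₀ ≤ E := by rwa [SteadyWindow.meanEnergy_const] at hE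
  have hG : ε ≤ ν * G₀ := by rwa [SteadyWindow.meanDissipation_const ν hsm₀] at hD
  have hA0 : 0 ≤ A₀ := integral_nonneg fun x => by positivity
  have hG0 : 0 ≤ G₀ := gradNormSq_nonneg u₀
  have hGpos : 0 < G₀ := by
    by_contra hle
    push Not at hle
    have hG00 : G₀ = 0 := le_antisymm hle hG0
    rw [hG00, mul_zero] at hG
    exact absurd hG (not_le.2 hε)
  have hApos : 0 < A₀ := by
    by_contra hle
    push Not at hle
    have hA00 : A₀ = 0 := le_antisymm hle hA0
    have hcont : Continuous u₀ := hsm₀.continuous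
    have hint : Integrable (fun x => ‖u₀ x‖ ^ 2) := (hcont.norm.pow 2).integrable_unitAddTorus
    have hae : (fun x => ‖u₀ x‖ ^ 2) =ᵐ[volume] (fun _ => (0 : ℝ)) :=
      (integral_eq_zero_iff_of_nonneg (fun x => by positivity) hint).1 (by rwa [hA₀] at hA00)
    have hfun : (fun x => ‖u₀ x‖ ^ 2) = fun _ => (0 : ℝ) :=
      (Continuous.ae_eq_iff_eq volume (hcont.norm.pow 2) continuous_const).1 hae
    have hu0 : u₀ = 0 := by
      funext x
      have h := congrFun hfun x
      simpa using h
    have hzero : G₀ = 0 := by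
      rw [hG₀, hu0]
      simp [gradNormSq, Torus.partialDeriv, Torus.lineDeriv]
    exact absurd hzero (ne_of_gt hGpos)
  -- the finite degenerate set on `[1/2, 2]`
  set F : Set ℝ := {t : ℝ | t ∈ Set.Icc (1 / 2 : ℝ) 2 ∧ Torus.IsLinNSEigenvalue ν (fun x => t • u₀ x) 0} with hF
  have hFfin : F.Finite := segmentNondeg_finite hν hsm₀ hdiv₀ (by norm_num : (0 : ℝ) < 1 / 2) 2
  -- pick `t ∈ (1, 1 + min δ (1/20)) \ F`
  have hm : 0 < min δ (1 / 20 : ℝ) := lt_min hδ (by norm_num)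
  have hinf : (Set.Ioo (1 : ℝ) (1 + min δ (1 / 20))).Infinite := Set.Ioo_infinite (by linarith)
  obtain ⟨t, ⟨ht1, ht2⟩, htF⟩ := (hinf.sdiff hFfin).nonempty
  have htδ : |t - 1| < δ := by
    rw [abs_of_pos (by linarith)]
    linarith [min_le_left δ (1 / 20 : ℝ)]
  have ht20 : t < 1 + 1 / 20 := by linarith [min_le_right δ (1 / 20 : ℝ)]
  have htIcc : t ∈ Set.Icc (1 / 2 : ℝ) 2 := ⟨by linarith, by linarith⟩
  have hnd : ¬ Torus.IsLinNSEigenvalue ν (fun x => t • u₀ x) 0 := fun h => htF ⟨htIcc, h⟩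
  refine ⟨t, htδ, ?_⟩
  -- the segment state `t•u₀` : steady for the designer force, smooth, budgets scaled by `t²`
  set ft : UnitAddTorus (Fin 3) → EuclideanSpace ℝ (Fin 3) := fun x => t ^ 2 • f x + ((t ^ 2 - t) * ν) • laplacian u₀ x with hft
  have hstt : Torus.IsSteadyNSState ν ft (fun x => t • u₀ x) (fun x => t ^ 2 * p₀ x) :=
    SegmentSteadyForce.stub_segmentSteadyForce ν t f u₀ p₀ hst
  have hsmt : IsSmooth (fun x => t • u₀ x) := hstt.smooth_velocity.isSmooth_slice (Set.mem_univ (0 : ℝ))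
  have hfts : IsSmooth ft := (hfs.smul (t ^ 2)).add (hsm₀.laplacian.smul ((t ^ 2 - t) * ν))
  -- budgets of `t•u₀`
  have hAt : (∫ x, ‖t • u₀ x‖ ^ 2) = t ^ 2 * A₀ := by
    have h := (SegmentBudget.stub_segmentBudget ν t u₀ hsm₀).1
    rwa [SteadyWindow.meanEnergy_const, SteadyWindow.meanEnergy_const] at h
  have hGt : ν * gradNormSq (fun x => t • u₀ x) = t ^ 2 * (ν * G₀) := by
    have h := (SegmentBudget.stub_segmentBudget ν t u₀ hsm₀).2
    rwa [SteadyWindow.meanDissipation_const ν hsmt, SteadyWindow.meanDissipation_const ν hsm₀] at h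
  -- the persistence radius at `(ft, t•u₀)`
  set δ' : ℝ := min (A₀ / 10) (ε / (13 * ν)) with hδ'
  have hδ'0 : 0 < δ' := lt_min (by positivity) (by positivity)
  have hδ'1 : δ' ≤ A₀ / 10 := min_le_left _ _
  have hδ'2 : δ' ≤ ε / (13 * ν) := min_le_right _ _
  obtain ⟨r, hr, hball⟩ := PersistSmoothForce.stub_persistSmoothForce ν ft (fun x => t • u₀ x) (fun x => t ^ 2 * p₀ x) δ' hν hfts hstt hnd hδ'0
  refine ⟨r, hr, fun g hgs hgd hg0 hdist => ?_⟩
  obtain ⟨u', p', hst', -, hH1⟩ := hball g hgs hgd hg0 (by simpa [hft] using hdist)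
  have hsm' : IsSmooth u' := hst'.smooth_velocity.isSmooth_slice (Set.mem_univ (0 : ℝ))
  have hL2 : 0 ≤ ∫ x, ‖u' x - t • u₀ x‖ ^ 2 := integral_nonneg fun _ => sq_nonneg _
  have hH1' : 0 ≤ gradNormSq (fun x => u' x - t • u₀ x) := gradNormSq_nonneg _
  have hdist' : (∫ x, ‖u' x - t • u₀ x‖ ^ 2) + gradNormSq (fun x => u' x - t • u₀ x) < δ' := hH1
  have hdL : ∫ x, ‖u' x - t • u₀ x‖ ^ 2 ≤ δ' := by linarith
  have hdG : gradNormSq (fun x => u' x - t • u₀ x) ≤ δ' := by linarith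
  refine ⟨u', p', hst', ?_, ?_⟩
  · rw [SteadyWindow.meanEnergy_const]
    have h := SteadyWindow.integral_norm_sq_le hsmt.continuous hsm'.continuous (by norm_num : (0 : ℝ) < 1 / 2)
    rw [hAt] at h
    have h10 : (∫ x, ‖u' x - t • u₀ x‖ ^ 2) ≤ A₀ / 10 := hdL.trans hδ'1
    have ht2 : t ^ 2 ≤ (1 + 1 / 20) ^ 2 := by
      exact pow_le_pow_left₀ (by linarith) ht20.le 2
    norm_num at h ht2
    nlinarith
  · rw [SteadyWindow.meanDissipation_const ν hsm']
    have h := SteadyWindow.gradNormSq_le hsmt hsm' (by norm_num : (0 : ℝ) < 1 / 2)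
    have h13 : gradNormSq (fun x => u' x - t • u₀ x) ≤ ε / (13 * ν) := hdG.trans hδ'2
    have h13' : ν * gradNormSq (fun x => u' x - t • u₀ x) ≤ ε / 13 := by
      calc ν * gradNormSq (fun x => u' x - t • u₀ x) ≤ ν * (ε / (13 * ν)) := mul_le_mul_of_nonneg_left h13 hν.le
        _ = ε / 13 := by field_simp
    norm_num at h
    have h2 : ν * gradNormSq (fun x => t • u₀ x) ≤ ν * (3 / 2 * gradNormSq u' + 3 * gradNormSq (fun x => u' x - t • u₀ x)) :=
      mul_le_mul_of_nonneg_left h hν.le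
    rw [hGt] at h2
    have ht1' : 1 ≤ t ^ 2 := by nlinarith
    have hνG0 : 0 ≤ ν * G₀ := mul_nonneg hν.le hG0
    nlinarith

end Poly

end Summit.AnomalousDissipation.AnomalousDissipation.Theorems.RobustLoudUpgrade

end
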